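import Summits.ResolutionOfSingularities.ResolutionOfSingularities.Theorems.DeltaCutStellarWild

/-!
# StellarCut T18b — «WildCut» §Carve: the column's carve with the tame and the wide wild cells DISCHARGED
# (lens-6 «barrier-complement carving», g34; critic ROW 241)

Writer split of the lens node `DeltaCutStellarWild.lean` (PIN 978611a1, 409 l > the gate's 400-line limit for Theorems files with
proofs), permitted by ROW 241 (ii): this file is `import …Theorems.DeltaCutStellarWild` + the node's `open` lines + its `section Carve`
VERBATIM; no other byte changed.  See `Theorems/DeltaCutStellarWild.lean` for the node docstring (§Cells, §CopShape, §Labels, §Round,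
§Law = THE WILD COPRIME LAW `worNCHypWildCop_holds`).
[cite: Kollar2007, (3.111) Step 3] [cite: CossartPiltant2008, Prop. 4.2 (a)]
-/

noncomputable section

open CategoryTheory CategoryTheory.Limits AlgebraicGeometry TopologicalSpace IsLocalRing
open Literature.AlgebraicGeometry.Resolution

namespace Summit.ResolutionOfSingularities.ResolutionOfSingularities.Theorems.DeltaCutClasses

open Summit.ResolutionOfSingularities.ResolutionOfSingularities.Theorems
open WeakOrderReduction ForcedTowerClasses

/-! ### §Carve — the column's carve with the tame and the wide wild cells DISCHARGED -/

section Carve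

open SubfieldContactClasses

/-- **THE CARVE AFTER `WORNC`, `WORNCHypTame` AND `WORNCHypWildCop`**:
`E1NCHypWildRest → E1NCEntryPerpetual → E1TopSFrozenOffNC → E1TopSHeavy`. [new] -/
theorem e1TopSHeavy_of_wildRest (hR : E1NCHypWildRest) (hE : E1NCEntryPerpetual) (hO : E1TopSFrozenOffNC) : E1TopSHeavy :=
  e1TopSHeavy_of_wild (e1NCHypWild_of_rest hR) hE hO

/-- exact remainder form: `E1NCHypWildRest → E1TopSHeavyOffNC → E1TopSHeavy`. [new] -/
theorem e1TopSHeavy_of_wildRest_offNC (hR : E1NCHypWildRest) (hO : E1TopSHeavyOffNC) : E1TopSHeavy :=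
  e1TopSHeavy_of_wild_offNC (e1NCHypWild_of_rest hR) hO

/-- edge to the live aside (item 27045): under `E 5`, `E1NCHypWildRest → E1NCEntryPerpetual → E1TopSFrozenOffNC → E1TopGHeavy`.
[new] -/
theorem e1TopGHeavy_of_wildRest (h5 : E 5) (hR : E1NCHypWildRest) (hE : E1NCEntryPerpetual) (hO : E1TopSFrozenOffNC) :
    E1TopGHeavy :=
  e1TopGHeavy_of_wild h5 (e1NCHypWild_of_rest hR) hE hO

/-- edge to the column item (26971): under `SubfieldContactAbs` and `E 5`,
`E1NCHypWildRest → E1NCEntryPerpetual → E1TopSFrozenOffNC → E1TopNoAbs`. [new] -/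
theorem e1TopNoAbs_of_wildRest (hSC : SubfieldContactAbs) (h5 : E 5) (hR : E1NCHypWildRest) (hE : E1NCEntryPerpetual)
    (hO : E1TopSFrozenOffNC) : E1TopNoAbs :=
  e1TopNoAbs_of_wild hSC h5 (e1NCHypWild_of_rest hR) hE hO

/-- summit edge of the column: under `SubfieldContactAbs` and `E 5`,
`E1NCHypWildRest → E1NCEntryPerpetual → E1TopSFrozenOffNC → E 1`. [new] -/
theorem e_one_of_wildRest (hSC : SubfieldContactAbs) (h5 : E 5) (hR : E1NCHypWildRest) (hE : E1NCEntryPerpetual)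
    (hO : E1TopSFrozenOffNC) : E 1 :=
  e_one_of_wild hSC h5 (e1NCHypWild_of_rest hR) hE hO

end Carve

end Summit.ResolutionOfSingularities.ResolutionOfSingularities.Theorems.DeltaCutClasses
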